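import Summits.KontsevichZagierPeriods.KontsevichZagierPeriods.Theses.SymplecticScissors
import Literature.NumberTheory.Transcendental.KZSemiCanonicalReductionProofs
import Literature.NumberTheory.Transcendental.KZLogCalculus
import Literature.NumberTheory.Transcendental.SemialgebraicMapsProofs

/-!
# `PlanarCompiler`, line `twist-restoring-shear`: the cell compiler `Θ` (stub 1)

Crux stmt-KontsevichZagierPeriods-10058 (route SymplecticScissors), stub `stub_cellCompiler` of
the lead skeleton `Cruxes/PlanarCompiler/Lines/twist-restoring-shear.lean`.

`Θ : FormalRep →+ FormalRep` is the additive map sending a 1-dimensional representation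
`[∫_σ f]` to `[cell f⁺] − [cell f⁻]`, where
`cell f⁺ = {p : ℝ² | (p 0) ∈ σ, 0 < p 1 < f (p 0)}` and `cell f⁻` likewise with `−f`, both as
honest integrand-`1` planar representations, and every generator of dimension `≠ 1` to `0`
(`FreeAbelianGroup.lift`). The two analytic inputs: the open cell under the graph of a
`ℚ`-semialgebraic function is `ℚ`-semialgebraic (strict hypograph, Tarski–Seidenberg), and it has
finite area (it lies in the closed band `{x ∈ σ, 0 ≤ t ≤ f x}`, on which `1` is integrable by
Tonelli along the last coordinate, `KZlog.integrableOn_band_of_lintegral_fibre_le`, the fibre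
integral `vol [0, f x] = (f x)⁺ ≤ |f x|` being dominated by the integrable `f`).
-/

noncomputable section

open MeasureTheory Set
open Literature.NumberTheory.Transcendental Literature.ModelTheory.ExponentialFields
open Summit.KontsevichZagierPeriods.KontsevichZagierPeriods.Theses.SymplecticScissors

namespace Summit.KontsevichZagierPeriods.SymplecticScissors.PlanarCompilerProof

/-- The strict hypograph `{(x, t) | x ∈ s, t < f x}` of a real `ℚ`-semialgebraic function is
`ℚ`-semialgebraic (graph elimination / Tarski–Seidenberg, as for the closed hypograph
`IsSemialgebraicFunOn.isSemialgebraic_setOf_le`). -/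
private theorem isSemialgebraic_setOf_lt {m : ℕ} {s : Set (Fin m → ℝ)} {f : (Fin m → ℝ) → ℝ}
    (hf : IsSemialgebraicFunOn ℚ s f) :
    IsSemialgebraic ℚ
      {v : Fin (m + 1) → ℝ | Fin.init v ∈ s ∧ v (Fin.last m) < f (Fin.init v)} := by
  have hT : IsSemialgebraic ℚ
      {u : Fin (m + 2) → ℝ | u (Fin.castSucc (Fin.last m)) < u (Fin.last (m + 1))} := by
    simpa using isSemialgebraic_setOf_eval_lt (k := ℚ) (R := ℝ)
      (MvPolynomial.X (Fin.castSucc (Fin.last m))) (MvPolynomial.X (Fin.last (m + 1)))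
  convert hf.isSemialgebraic_setOf_snoc_mem tarski_seidenberg_real_holds hT using 1
  ext v
  simp

/-- The open cell `{(x, t) | x ∈ σ, 0 < t < f x} ⊆ ℝ²` under the graph of a `ℚ`-semialgebraic
integrable function `f` on `σ ⊆ ℝ¹` is `ℚ`-semialgebraic and has finite area. -/
private theorem isSemialgebraic_cell_and_volume_ne_top {σ : Set (Fin 1 → ℝ)} {f : (Fin 1 → ℝ) → ℝ}
    (hσ : IsSemialgebraic ℚ σ) (hf : IsSemialgebraicFunOn ℚ σ f) (hfi : IntegrableOn f σ) :
    IsSemialgebraic ℚ {p : Fin 2 → ℝ | (fun _ : Fin 1 => p 0) ∈ σ ∧ 0 < p 1 ∧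
        p 1 < f (fun _ : Fin 1 => p 0)} ∧
      volume {p : Fin 2 → ℝ | (fun _ : Fin 1 => p 0) ∈ σ ∧ 0 < p 1 ∧
        p 1 < f (fun _ : Fin 1 => p 0)} ≠ ⊤ := by
  have hinit : ∀ p : Fin 2 → ℝ, (fun _ : Fin 1 => p 0) = Fin.init p := fun p => by
    funext i
    fin_cases i
    rfl
  have hcell : {p : Fin 2 → ℝ | (fun _ : Fin 1 => p 0) ∈ σ ∧ 0 < p 1 ∧
      p 1 < f (fun _ : Fin 1 => p 0)} =
      {v : Fin 2 → ℝ | Fin.init v ∈ σ ∧ v (Fin.last 1) < f (Fin.init v)} ∩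
        {v | 0 < v (Fin.last 1)} := by
    ext p
    simp only [hinit, mem_setOf_eq, mem_inter_iff]
    change _ ↔ (Fin.init p ∈ σ ∧ p 1 < f (Fin.init p)) ∧ 0 < p 1
    tauto
  constructor
  · rw [hcell]
    refine (isSemialgebraic_setOf_lt hf).inter ?_
    simpa using isSemialgebraic_setOf_eval_pos (k := ℚ) (R := ℝ)
      (MvPolynomial.X (Fin.last 1) : MvPolynomial (Fin 2) ℚ)
  · have hzero : IsSemialgebraicFunOn ℚ σ (fun _ => (0 : ℝ)) := by
      simpa using isSemialgebraicFunOn_ratCast hσ 0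
    have hB : IsSemialgebraic ℚ (KZlog.band σ (fun _ => 0) f) := KZlog.isSemialgebraic_band hzero hf
    have hBm : MeasurableSet (KZlog.band σ (fun _ => 0) f) :=
      IsSemialgebraic.measurableSet_holds hB
    have hint : IntegrableOn (fun _ => (1 : ℝ)) (KZlog.band σ (fun _ => 0) f) := by
      refine KZlog.integrableOn_band_of_lintegral_fibre_le (IsSemialgebraic.measurableSet_holds hσ)
        hBm (fun x t => KZlog.snoc_mem_band) aestronglyMeasurable_const (K := f)
        (fun x _ => ?_) hfi
      rw [setLIntegral_const, Real.volume_Icc, sub_zero, enorm_one, one_mul,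
        Real.enorm_eq_ofReal_abs]
      exact ENNReal.ofReal_le_ofReal (le_abs_self _)
    have hfin : volume (KZlog.band σ (fun _ => 0) f) < ⊤ := by
      rw [integrableOn_const_iff] at hint
      exact hint.resolve_left (by simp)
    refine ne_of_lt (lt_of_le_of_lt (measure_mono fun p hp => ?_) hfin)
    rw [KZlog.mem_band]
    simp only [mem_setOf_eq, hinit] at hp
    exact ⟨hp.1, hp.2.1.le, hp.2.2.le⟩

/-- **Stub 1 (M).** The cell compiler `Θ`: the additive map on `FormalRep` sending a 1-dimensional representation `[∫_σ f]` to `[cell of f⁺] − [cell of f⁻]` (honest integrand-`1` planar representations under the graphs of `f` and `−f` over `σ`) and every other generator to `0` (`FreeAbelianGroup.lift`; semialgebraicity of the cells by Tarski–Seidenberg, finite area by Tonelli). -/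
theorem stub_cellCompiler :
    ∃ Θ : KZ.FormalRep →+ KZ.FormalRep, ((∀ ρ : KZ.IntegralRep 1, ∃ s t : KZ.IntegralRep 2, s.domain = {p : Fin 2 → ℝ | (fun _ : Fin 1 => p 0) ∈ ρ.domain ∧ 0 < p 1 ∧ p 1 < ρ.integrand (fun _ : Fin 1 => p 0)} ∧ t.domain = {p : Fin 2 → ℝ | (fun _ : Fin 1 => p 0) ∈ ρ.domain ∧ 0 < p 1 ∧ p 1 < -ρ.integrand (fun _ : Fin 1 => p 0)} ∧ (∀ p ∈ s.domain, s.integrand p = 1) ∧ (∀ p ∈ t.domain, t.integrand p = 1) ∧ Θ (KZ.of ρ) = KZ.of s - KZ.of t) ∧ (∀ (n : ℕ) (ρ : KZ.IntegralRep n), n ≠ 1 → Θ (KZ.of ρ) = 0)) := by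
  have hS : ∀ ρ : KZ.IntegralRep 1, ∃ s : KZ.IntegralRep 2,
      s.domain = {p : Fin 2 → ℝ | (fun _ : Fin 1 => p 0) ∈ ρ.domain ∧ 0 < p 1 ∧
        p 1 < ρ.integrand (fun _ : Fin 1 => p 0)} ∧ s.integrand = fun _ => 1 := fun ρ => by
    obtain ⟨h₁, h₂⟩ := isSemialgebraic_cell_and_volume_ne_top ρ.isSemialgebraic_domain
      ρ.isSemialgebraicFunOn_integrand ρ.integrableOn
    exact KZ.exists_oneRep h₁ h₂
  have hT : ∀ ρ : KZ.IntegralRep 1, ∃ t : KZ.IntegralRep 2,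
      t.domain = {p : Fin 2 → ℝ | (fun _ : Fin 1 => p 0) ∈ ρ.domain ∧ 0 < p 1 ∧
        p 1 < -ρ.integrand (fun _ : Fin 1 => p 0)} ∧ t.integrand = fun _ => 1 := fun ρ => by
    obtain ⟨h₁, h₂⟩ := isSemialgebraic_cell_and_volume_ne_top ρ.isSemialgebraic_domain
      ρ.isSemialgebraicFunOn_integrand.neg ρ.integrableOn.neg
    exact KZ.exists_oneRep h₁ h₂
  choose S hSd hSi using hS
  choose T hTd hTi using hT
  refine ⟨FreeAbelianGroup.lift fun x => match x with
      | ⟨1, ρ⟩ => KZ.of (S ρ) - KZ.of (T ρ)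
      | _ => 0, fun ρ => ⟨S ρ, T ρ, hSd ρ, hTd ρ, fun p _ => by rw [hSi], fun p _ => by rw [hTi],
      ?_⟩, fun n ρ hn => ?_⟩
  · simp [KZ.of]
  · rcases n with _ | _ | n
    · simp [KZ.of]
    · exact absurd rfl hn
    · simp [KZ.of]

end Summit.KontsevichZagierPeriods.SymplecticScissors.PlanarCompilerProof
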